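import Mathlib.Analysis.SpecialFunctions.Pow.Real
import Mathlib.Analysis.SpecialFunctions.Pow.Asymptotics
import Mathlib.Analysis.SpecialFunctions.Log.Basic
import HarnessLib

/-!
# The uniform ratio lemma `|μ^k w_{n-k}/w_n - 1| ≤ K(k n^{-1/4} + 1/log n)`, model-free

Topic `Literature/Probability/RandomPlanarGeometry` (generic engine; the bridge instance is
`SAWKestenMeasureRate.lean`, `ratio_uniform_of_oneStepRate`, whose proof this file repeats verbatim for an
arbitrary positive sequence; the half-space instance is `SAWHalfSpaceKestenRate.lean`).

Source: N. Madras, G. Slade, *The Self-Avoiding Walk* (1993), Theorem 8.3.1, proof, eq. (8.3.11) (book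
p. 274): `b_{n-k}/b_n → μ^{-k}` for each fixed `k`, from Theorem 7.3.4 (d) — no rate, no uniformity in `k`.
NEW (not in print): `RatioUniform.ratio_uniform_of_rates` — for ANY positive sequence `w` and `μ > 0` with
`|w_{N+2}/w_N - μ²| ≤ K N^{-1/4}` (`N ≥ N₀`) and `|w_{N+1}/w_N - μ| ≤ K/log N` (`N ≥ 2`):
`∃ K' ≥ 0, ∃ N₁, ∀ n ≥ N₁, ∀ k, k⁵ ≤ n → |μ^k w_{n-k}/w_n - 1| ≤ K'(k n^{-1/4} + 1/log n)` (even `k = 2j`: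
a product of `j` two-step ratios at indices `≥ n/2`, `evenShift_prod_bounds` / `evenShift_ratio`; odd `k`:
one more factor `μ w_{n-1}/w_n = 1 + O(1/log n)`, `oddShift_ratio`). Instances: `w = b` (bridges), `w = h`
(half-space walks, lane «pcv-sawmu» route R27).
-/

noncomputable section

open Finset Filter Topology
open scoped BigOperators

namespace Literature.Probability.RandomPlanarGeometry.SAW

namespace RatioUniform

/-- `(1 + x)^j ≤ 1 + 2jx` for `x ≥ 0` and `jx ≤ 1/2`. [folklore] -/
private theorem one_add_pow_le_one_add_two_mul {x : ℝ} (hx : 0 ≤ x) :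
    ∀ j : ℕ, (j : ℝ) * x ≤ 1 / 2 → (1 + x) ^ j ≤ 1 + 2 * j * x := by
  intro j
  induction j with
  | zero => intro _; simp
  | succ j ih =>
    intro hj
    have hjs : ((j + 1 : ℕ) : ℝ) = (j : ℝ) + 1 := by push_cast; ring
    rw [hjs] at hj ⊢
    have hj0 : (0 : ℝ) ≤ j := Nat.cast_nonneg j
    have h1 := ih (by nlinarith)
    have h3 : (1 + x) ^ j * (1 + x) ≤ (1 + 2 * j * x) * (1 + x) := mul_le_mul_of_nonneg_right h1 (by linarith)
    rw [pow_succ]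
    nlinarith

/-- Bernoulli: `1 - jx ≤ (1 - x)^j` for `x ≤ 2`. [folklore] -/
private theorem one_sub_mul_le_one_sub_pow {x : ℝ} (hx2 : x ≤ 2) (j : ℕ) :
    1 - (j : ℝ) * x ≤ (1 - x) ^ j := by
  have h := one_add_mul_le_pow (show (-2 : ℝ) ≤ -x by linarith) j
  have h1 : (1 : ℝ) + -x = 1 - x := by ring
  rw [h1] at h
  linarith

/-- `M^{-1/4} ≤ 2 n^{-1/4}` for `1 ≤ n ≤ 2M`. [folklore] -/
private theorem rpow_neg_quarter_window {n M : ℕ} (hn : 1 ≤ n) (h2M : n ≤ 2 * M) :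
    (M : ℝ) ^ (-(1 : ℝ) / 4) ≤ 2 * (n : ℝ) ^ (-(1 : ℝ) / 4) := by
  have hn0 : (0 : ℝ) ≤ n := Nat.cast_nonneg n
  have hMr : (n : ℝ) / 2 ≤ M := by
    have : (n : ℝ) ≤ 2 * M := by exact_mod_cast h2M
    linarith
  have hn0' : (0 : ℝ) < n := by exact_mod_cast (show 0 < n by omega)
  have h1 : (M : ℝ) ^ (-(1 : ℝ) / 4) ≤ ((n : ℝ) / 2) ^ (-(1 : ℝ) / 4) :=
    Real.rpow_le_rpow_of_nonpos (by positivity) hMr (by norm_num)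
  have h2 : ((n : ℝ) / 2) ^ (-(1 : ℝ) / 4) = (n : ℝ) ^ (-(1 : ℝ) / 4) / (2 : ℝ) ^ (-(1 : ℝ) / 4) :=
    Real.div_rpow hn0 (by norm_num) _
  have h3 : (1 / 2 : ℝ) ≤ (2 : ℝ) ^ (-(1 : ℝ) / 4) := by
    rw [show (-(1 : ℝ) / 4) = -((1 : ℝ) / 4) by ring, Real.rpow_neg (by norm_num), one_div]
    refine inv_anti₀ (by positivity) ?_
    calc (2 : ℝ) ^ ((1 : ℝ) / 4) ≤ (2 : ℝ) ^ (1 : ℝ) :=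
          Real.rpow_le_rpow_of_exponent_le (by norm_num) (by norm_num)
      _ = 2 := Real.rpow_one 2
  have h4 : 0 ≤ (n : ℝ) ^ (-(1 : ℝ) / 4) := Real.rpow_nonneg hn0 _
  calc (M : ℝ) ^ (-(1 : ℝ) / 4) ≤ (n : ℝ) ^ (-(1 : ℝ) / 4) / (2 : ℝ) ^ (-(1 : ℝ) / 4) := by
        rw [← h2]; exact h1
    _ ≤ (n : ℝ) ^ (-(1 : ℝ) / 4) / (1 / 2) := div_le_div_of_nonneg_left h4 (by norm_num) h3
    _ = 2 * (n : ℝ) ^ (-(1 : ℝ) / 4) := by ring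

/-- `k⁵ ≤ n` gives `k ≤ n^{1/5}` (as reals). [folklore] -/
private theorem natCast_le_rpow_fifth {k n : ℕ} (hk : k ^ 5 ≤ n) : (k : ℝ) ≤ (n : ℝ) ^ ((1 : ℝ) / 5) := by
  have h5 : ((k : ℝ) ^ 5) ^ ((1 : ℝ) / 5) = k := by
    rw [show ((1 : ℝ) / 5) = ((5 : ℕ) : ℝ)⁻¹ by norm_num]
    exact Real.pow_rpow_inv_natCast (Nat.cast_nonneg k) (by norm_num)
  exact h5 ▸ Real.rpow_le_rpow (by positivity) (by exact_mod_cast hk) (by norm_num)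

/-- `k⁵ ≤ n` and `n ≥ 4` give `4k ≤ n`. [folklore] -/
private theorem four_mul_le_of_pow_five_le {k n : ℕ} (hk : k ^ 5 ≤ n) (hn : 4 ≤ n) : 4 * k ≤ n := by
  by_cases hk2 : 2 ≤ k
  · have h16 : 2 ^ 4 ≤ k ^ 4 := Nat.pow_le_pow_left hk2 4
    have : 16 * k ≤ k ^ 5 := by
      rw [show k ^ 5 = k ^ 4 * k by ring]
      have : (16 : ℕ) ≤ k ^ 4 := by simpa using h16
      exact Nat.mul_le_mul_right k this
    omega
  · omega

variable {w : ℕ → ℝ} {μ : ℝ}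

/-- Telescoping over even shifts (two-sided product bounds), for any positive sequence `w` and `μ > 0`:
with `x = 2c n^{-1/4} ≤ 1` and `|w_{N+2}/(μ² w_N) - 1| ≤ c N^{-1/4}` for `N ≥ N₁`, for every `j` with
`N₁ + 2j ≤ n`, `4j ≤ n`: `(1 - x)^j ≤ w_n/(μ^{2j} w_{n-2j}) ≤ (1 + x)^j`.
[cite: MadrasSlade1993, Theorem 8.3.1 (proof, eq. (8.3.11), quantitative form; model-free)] -/
theorem evenShift_prod_bounds (hw : ∀ n, 0 < w n) (hμ : 0 < μ) {c : ℝ} {N₁ : ℕ} (hc : 0 ≤ c)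
    (hdev : ∀ N : ℕ, N₁ ≤ N → |w (N + 2) / (μ ^ 2 * w N) - 1| ≤ c * (N : ℝ) ^ (-(1 : ℝ) / 4))
    {n : ℕ} (hn : 1 ≤ n) (hx1 : 2 * c * (n : ℝ) ^ (-(1 : ℝ) / 4) ≤ 1) :
    ∀ j : ℕ, N₁ + 2 * j ≤ n → 4 * j ≤ n →
      (1 - 2 * c * (n : ℝ) ^ (-(1 : ℝ) / 4)) ^ j ≤ w n / (μ ^ (2 * j) * w (n - 2 * j)) ∧
        w n / (μ ^ (2 * j) * w (n - 2 * j)) ≤ (1 + 2 * c * (n : ℝ) ^ (-(1 : ℝ) / 4)) ^ j := by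
  set x : ℝ := 2 * c * (n : ℝ) ^ (-(1 : ℝ) / 4) with hxdef
  have hx0 : 0 ≤ x := by rw [hxdef]; exact mul_nonneg (by linarith) (Real.rpow_nonneg (Nat.cast_nonneg n) _)
  intro j
  induction j with
  | zero =>
    intro _ _
    simp only [Nat.mul_zero, pow_zero, Nat.sub_zero, one_mul]
    rw [div_self (hw n).ne']
    exact ⟨le_rfl, le_rfl⟩
  | succ j ih =>
    intro hN hj
    have hN' : N₁ + 2 * j ≤ n := by omega
    have hj' : 4 * j ≤ n := by omega
    obtain ⟨ihlo, ihhi⟩ := ih hN' hj'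
    -- the new factor `f = w_{n-2j}/(μ² w_{n-2j-2})`, index `N = n - 2j - 2 ≥ N₁`, `n ≤ 2N`
    set N : ℕ := n - 2 * (j + 1) with hNdef
    have hdevN := hdev N (by omega)
    rw [show N + 2 = n - 2 * j by omega] at hdevN
    have hNpow : (N : ℝ) ^ (-(1 : ℝ) / 4) ≤ 2 * (n : ℝ) ^ (-(1 : ℝ) / 4) :=
      rpow_neg_quarter_window hn (by omega)
    set f : ℝ := w (n - 2 * j) / (μ ^ 2 * w N) with hfdef
    have hfx : |f - 1| ≤ x := by
      refine hdevN.trans ?_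
      calc c * (N : ℝ) ^ (-(1 : ℝ) / 4) ≤ c * (2 * (n : ℝ) ^ (-(1 : ℝ) / 4)) :=
            mul_le_mul_of_nonneg_left hNpow hc
        _ = x := by rw [hxdef]; ring
    have hflo : 1 - x ≤ f := by have := (abs_le.1 hfx).1; linarith
    have hfhi : f ≤ 1 + x := by have := (abs_le.1 hfx).2; linarith
    have hf0 : 0 ≤ f := by rw [hfdef]; exact div_nonneg (hw _).le (mul_pos (pow_pos hμ 2) (hw _)).le
    -- `r_{j+1} = r_j * f`
    have hprod : w n / (μ ^ (2 * (j + 1)) * w (n - 2 * (j + 1))) =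
        w n / (μ ^ (2 * j) * w (n - 2 * j)) * f := by
      rw [hfdef, ← hNdef, show 2 * (j + 1) = 2 * j + 2 by ring, pow_add]
      have hb1 := (hw (n - 2 * j)).ne'
      have hb2 := (hw N).ne'
      have hμ0 : μ ≠ 0 := hμ.ne'
      field_simp
    rw [hprod, pow_succ, pow_succ]
    have hlo0 : 0 ≤ 1 - x := by linarith
    constructor
    · exact mul_le_mul ihlo hflo hlo0 (le_trans (pow_nonneg hlo0 j) ihlo)
    · exact mul_le_mul ihhi hfhi hf0 (pow_nonneg (by linarith) j)

/-- Even shifts, for any positive sequence: with `x = 2c n^{-1/4}` and `jx ≤ 1/2` (and the hypotheses of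
the product bounds), `|μ^{2j} w_{n-2j}/w_n - 1| ≤ 4jx`.
[cite: MadrasSlade1993, Theorem 8.3.1 (proof, eq. (8.3.11), quantitative form; model-free)] -/
theorem evenShift_ratio (hw : ∀ n, 0 < w n) (hμ : 0 < μ) {c : ℝ} {N₁ : ℕ} (hc : 0 ≤ c)
    (hdev : ∀ N : ℕ, N₁ ≤ N → |w (N + 2) / (μ ^ 2 * w N) - 1| ≤ c * (N : ℝ) ^ (-(1 : ℝ) / 4))
    {n j : ℕ} (hn : 1 ≤ n) (hN : N₁ + 2 * j ≤ n) (hj : 4 * j ≤ n)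
    (hx1 : 2 * c * (n : ℝ) ^ (-(1 : ℝ) / 4) ≤ 1)
    (hjx : (j : ℝ) * (2 * c * (n : ℝ) ^ (-(1 : ℝ) / 4)) ≤ 1 / 2) :
    |μ ^ (2 * j) * w (n - 2 * j) / w n - 1| ≤ 4 * j * (2 * c * (n : ℝ) ^ (-(1 : ℝ) / 4)) := by
  set x : ℝ := 2 * c * (n : ℝ) ^ (-(1 : ℝ) / 4) with hxdef
  have hx0 : 0 ≤ x := by rw [hxdef]; exact mul_nonneg (by linarith) (Real.rpow_nonneg (Nat.cast_nonneg n) _)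
  obtain ⟨hlo, hhi⟩ := evenShift_prod_bounds hw hμ hc hdev hn hx1 j hN hj
  set r : ℝ := w n / (μ ^ (2 * j) * w (n - 2 * j)) with hrdef
  have hj0 : (0 : ℝ) ≤ j := Nat.cast_nonneg j
  have hrlo : 1 - j * x ≤ r := le_trans (one_sub_mul_le_one_sub_pow (by linarith) j) hlo
  have hrhi : r ≤ 1 + 2 * j * x := le_trans hhi (one_add_pow_le_one_add_two_mul hx0 j hjx)
  have hrpos : 1 / 2 ≤ r := by linarith
  have hr0 : 0 < r := by linarith
  -- the target quantity is `1/r`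
  rw [show μ ^ (2 * j) * w (n - 2 * j) / w n = r⁻¹ by rw [hrdef, inv_div]]
  have hr0' : r ≠ 0 := hr0.ne'
  have hid : r⁻¹ - 1 = (1 - r) / r := by field_simp
  rw [hid, abs_div, abs_of_pos hr0, div_le_iff₀ hr0]
  have h1 : |1 - r| ≤ 2 * j * x := by
    rw [abs_le]; constructor <;> linarith
  calc |1 - r| ≤ 2 * j * x := h1
    _ = 4 * j * x * (1 / 2) := by ring
    _ ≤ 4 * j * x * r := mul_le_mul_of_nonneg_left hrpos (by positivity)

/-- Odd shifts, for any positive sequence: `μ^{2j+1} w_{n-2j-1}/w_n = (μ^{2j} w_{(n-1)-2j}/w_{n-1}) ·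
(μ w_{n-1}/w_n)`; the first factor is an even shift at `n - 1`, the second is `1 + O(1/log n)` by the
one-step rate. [cite: MadrasSlade1993, Theorem 8.3.1 (proof, eq. (8.3.11), quantitative form; model-free)] -/
theorem oddShift_ratio (hw : ∀ n, 0 < w n) (hμ : 0 < μ) {c K₂ : ℝ} {N₁ : ℕ} (hc : 0 ≤ c) (hK₂ : 0 ≤ K₂)
    (hdev : ∀ N : ℕ, N₁ ≤ N → |w (N + 2) / (μ ^ 2 * w N) - 1| ≤ c * (N : ℝ) ^ (-(1 : ℝ) / 4))
    (hR16 : ∀ N : ℕ, 2 ≤ N → |w (N + 1) / w N - μ| ≤ K₂ / Real.log N)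
    {n j : ℕ} (hn : 3 ≤ n) (hN : N₁ + 2 * j ≤ n - 1) (hj : 4 * j ≤ n - 1)
    (hx1 : 4 * c * (n : ℝ) ^ (-(1 : ℝ) / 4) ≤ 1)
    (hjx : (j : ℝ) * (4 * c * (n : ℝ) ^ (-(1 : ℝ) / 4)) ≤ 1 / 2)
    (hlog : 4 * K₂ / μ ≤ Real.log n) :
    |μ ^ (2 * j + 1) * w (n - (2 * j + 1)) / w n - 1| ≤
      32 * j * c * (n : ℝ) ^ (-(1 : ℝ) / 4) + 4 * K₂ / (μ * Real.log n) := by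
  have hn1 : 1 ≤ n - 1 := by omega
  have hn0 : (0 : ℝ) < n := by exact_mod_cast (show 0 < n by omega)
  have hlogn : 0 < Real.log n := Real.log_pos (by exact_mod_cast (show 1 < n by omega))
  have hr0 : 0 ≤ (n : ℝ) ^ (-(1 : ℝ) / 4) := Real.rpow_nonneg hn0.le _
  -- `(n-1)^{-1/4} ≤ 2 n^{-1/4}`
  have hpow : ((n - 1 : ℕ) : ℝ) ^ (-(1 : ℝ) / 4) ≤ 2 * (n : ℝ) ^ (-(1 : ℝ) / 4) :=
    rpow_neg_quarter_window (by omega) (by omega)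
  -- the even factor at `n - 1`
  have hcmp : 2 * c * ((n - 1 : ℕ) : ℝ) ^ (-(1 : ℝ) / 4) ≤ 4 * c * (n : ℝ) ^ (-(1 : ℝ) / 4) := by
    have := mul_le_mul_of_nonneg_left hpow hc
    linarith
  have hx1' : 2 * c * ((n - 1 : ℕ) : ℝ) ^ (-(1 : ℝ) / 4) ≤ 1 := hcmp.trans hx1
  have hjx' : (j : ℝ) * (2 * c * ((n - 1 : ℕ) : ℝ) ^ (-(1 : ℝ) / 4)) ≤ 1 / 2 := by
    have hj0 : (0 : ℝ) ≤ j := Nat.cast_nonneg j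
    exact (mul_le_mul_of_nonneg_left hcmp hj0).trans hjx
  have hA := evenShift_ratio hw hμ hc hdev hn1 hN hj hx1' hjx'
  set A : ℝ := μ ^ (2 * j) * w (n - 1 - 2 * j) / w (n - 1) with hAdef
  have hA' : |A - 1| ≤ 16 * j * c * (n : ℝ) ^ (-(1 : ℝ) / 4) := by
    refine hA.trans ?_
    have hj0 : (0 : ℝ) ≤ j := Nat.cast_nonneg j
    calc 4 * (j : ℝ) * (2 * c * ((n - 1 : ℕ) : ℝ) ^ (-(1 : ℝ) / 4))
        ≤ 4 * (j : ℝ) * (2 * c * (2 * (n : ℝ) ^ (-(1 : ℝ) / 4))) := by gcongr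
      _ = 16 * j * c * (n : ℝ) ^ (-(1 : ℝ) / 4) := by ring
  -- the one-step factor `B = μ w_{n-1}/w_n`
  set t : ℝ := w n / w (n - 1) with htdef
  have ht0 : 0 < t := by rw [htdef]; exact div_pos (hw n) (hw (n - 1))
  have hR := hR16 (n - 1) (by omega)
  rw [show n - 1 + 1 = n by omega] at hR
  -- `log(n-1) ≥ log n / 2` for `n ≥ 3`
  have hlog1 : Real.log n / 2 ≤ Real.log ((n - 1 : ℕ) : ℝ) := by
    have h3 : (n : ℝ) ≤ ((n - 1 : ℕ) : ℝ) ^ 2 := by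
      have hm : (2 : ℝ) ≤ ((n - 1 : ℕ) : ℝ) := by exact_mod_cast (show 2 ≤ n - 1 by omega)
      have hn' : (n : ℝ) = ((n - 1 : ℕ) : ℝ) + 1 := by
        have : n = (n - 1) + 1 := by omega
        exact_mod_cast this
      rw [hn']; nlinarith
    have h4 : Real.log n ≤ Real.log (((n - 1 : ℕ) : ℝ) ^ 2) := Real.log_le_log hn0 h3
    rw [Real.log_pow] at h4; push_cast at h4; linarith
  have hlog1pos : 0 < Real.log ((n - 1 : ℕ) : ℝ) := by linarith
  set e : ℝ := K₂ / Real.log ((n - 1 : ℕ) : ℝ) with hedef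
  have he : e ≤ 2 * K₂ / Real.log n := by
    rw [hedef, div_le_div_iff₀ hlog1pos hlogn]
    have := mul_le_mul_of_nonneg_left hlog1 hK₂
    linarith
  have he0 : 0 ≤ e := by positivity
  have htμ : |t - μ| ≤ e := hR
  -- `e ≤ μ/2`
  have heμ : e ≤ μ / 2 := by
    refine he.trans ?_
    rw [div_le_iff₀ hlogn]
    have : 4 * K₂ ≤ Real.log n * μ := by rwa [div_le_iff₀ hμ] at hlog
    linarith
  have htlo : μ / 2 ≤ t := by have := (abs_le.1 htμ).1; linarith
  set B : ℝ := μ / t with hBdef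
  have hB1 : |B - 1| ≤ 2 * e / μ := by
    have hid : B - 1 = (μ - t) / t := by rw [hBdef]; field_simp
    rw [hid, abs_div, abs_of_pos ht0, div_le_iff₀ ht0]
    calc |μ - t| = |t - μ| := abs_sub_comm _ _
      _ ≤ e := htμ
      _ = 2 * e / μ * (μ / 2) := by field_simp
      _ ≤ 2 * e / μ * t := mul_le_mul_of_nonneg_left htlo (by positivity)
  have hB2 : B ≤ 2 := by rw [hBdef, div_le_iff₀ ht0]; linarith
  have hB0 : 0 ≤ B := by positivity
  -- the target is `A * B`
  have hq : μ ^ (2 * j + 1) * w (n - (2 * j + 1)) / w n = A * B := by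
    rw [hAdef, hBdef, htdef, show n - (2 * j + 1) = n - 1 - 2 * j by omega, pow_succ]
    have := (hw n).ne'; have := (hw (n - 1)).ne'
    field_simp
  rw [hq]
  have hsplit : A * B - 1 = (A - 1) * B + (B - 1) := by ring
  rw [hsplit]
  calc |(A - 1) * B + (B - 1)| ≤ |(A - 1) * B| + |B - 1| := abs_add_le _ _
    _ = |A - 1| * B + |B - 1| := by rw [abs_mul, abs_of_nonneg hB0]
    _ ≤ 16 * j * c * (n : ℝ) ^ (-(1 : ℝ) / 4) * 2 + 2 * e / μ := by
        have hj0 : (0 : ℝ) ≤ 16 * (j : ℝ) := by positivity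
        have h1 : |A - 1| * B ≤ 16 * j * c * (n : ℝ) ^ (-(1 : ℝ) / 4) * 2 :=
          mul_le_mul hA' hB2 hB0 (mul_nonneg (mul_nonneg hj0 hc) hr0)
        linarith [hB1]
    _ ≤ 32 * j * c * (n : ℝ) ^ (-(1 : ℝ) / 4) + 4 * K₂ / (μ * Real.log n) := by
        have h1 : 2 * e / μ ≤ 4 * K₂ / (μ * Real.log n) := by
          rw [div_le_div_iff₀ hμ (by positivity)]
          have := he
          rw [le_div_iff₀ hlogn] at this
          nlinarith
        linarith

/-- **The uniform ratio lemma, model-free**: for any positive sequence `w` and `μ > 0` with a two-step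
rate `|w_{N+2}/w_N - μ²| ≤ K N^{-1/4}` (`N ≥ N₀`) and a one-step rate `|w_{N+1}/w_N - μ| ≤ K/log N`
(`N ≥ 2`), there are `K' ≥ 0` and `N₁` with `|μ^k w_{n-k}/w_n - 1| ≤ K'(k n^{-1/4} + 1/log n)` for all
`n ≥ N₁` and all shifts `k` with `k⁵ ≤ n`.
[cite: MadrasSlade1993, Theorem 8.3.1 (proof, eq. (8.3.11); quantitative form, derived, model-free)] -/
theorem ratio_uniform_of_rates (hw : ∀ n, 0 < w n) (hμ : 0 < μ)
    (hTS : ∃ K : ℝ, ∃ N₀ : ℕ, ∀ N : ℕ, N₀ ≤ N → |w (N + 2) / w N - μ ^ 2| ≤ K * (N : ℝ) ^ (-(1 : ℝ) / 4))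
    (hR16 : ∃ K : ℝ, ∀ N : ℕ, 2 ≤ N → |w (N + 1) / w N - μ| ≤ K / Real.log N) :
    ∃ K : ℝ, 0 ≤ K ∧ ∃ N₀ : ℕ, ∀ n : ℕ, N₀ ≤ n → ∀ k : ℕ, k ^ 5 ≤ n →
      |μ ^ k * w (n - k) / w n - 1| ≤ K * ((k : ℝ) * (n : ℝ) ^ (-(1 : ℝ) / 4) + 1 / Real.log n) := by
  have hμ2 : 0 < μ ^ 2 := by positivity
  -- two-step input, as a relative deviation with a nonnegative constant
  obtain ⟨K₁', N₀, hTS'⟩ := hTS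
  set K₁ : ℝ := max K₁' 0 with hK₁def
  have hK₁ : 0 ≤ K₁ := le_max_right _ _
  set c : ℝ := K₁ / μ ^ 2 with hcdef
  have hc : 0 ≤ c := by positivity
  set N₁ : ℕ := max N₀ 1 with hN₁
  have hdev : ∀ N : ℕ, N₁ ≤ N → |w (N + 2) / (μ ^ 2 * w N) - 1| ≤ c * (N : ℝ) ^ (-(1 : ℝ) / 4) := by
    intro N hN
    have hN0 : N₀ ≤ N := le_trans (le_max_left _ _) hN
    have hr4 : 0 ≤ (N : ℝ) ^ (-(1 : ℝ) / 4) := Real.rpow_nonneg (Nat.cast_nonneg N) _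
    have habs : |w (N + 2) / w N - μ ^ 2| ≤ K₁ * (N : ℝ) ^ (-(1 : ℝ) / 4) :=
      (hTS' N hN0).trans (mul_le_mul_of_nonneg_right (le_max_left _ _) hr4)
    have hid : w (N + 2) / (μ ^ 2 * w N) - 1 = (w (N + 2) / w N - μ ^ 2) / μ ^ 2 := by
      have := (hw N).ne'
      field_simp
    rw [hid, abs_div, abs_of_pos hμ2, div_le_iff₀ hμ2]
    calc |w (N + 2) / w N - μ ^ 2| ≤ K₁ * (N : ℝ) ^ (-(1 : ℝ) / 4) := habs
      _ = K₁ / μ ^ 2 * (N : ℝ) ^ (-(1 : ℝ) / 4) * μ ^ 2 := by field_simp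
  -- one-step input, with a nonnegative constant
  obtain ⟨K₂', hR16'⟩ := hR16
  set K₂ : ℝ := max K₂' 0 with hK₂def
  have hK₂ : 0 ≤ K₂ := le_max_right _ _
  have hR16K : ∀ N : ℕ, 2 ≤ N → |w (N + 1) / w N - μ| ≤ K₂ / Real.log N := by
    intro N hN
    refine (hR16' N hN).trans ?_
    have hlog : 0 < Real.log N := Real.log_pos (by exact_mod_cast (show 1 < N by omega))
    exact div_le_div_of_nonneg_right (le_max_left _ _) hlog.le
  -- thresholds
  have heva : ∀ᶠ n : ℕ in atTop, 2 * N₁ + 6 ≤ n := eventually_ge_atTop _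
  have ht0 : Tendsto (fun n : ℕ => (n : ℝ) ^ (-((1 : ℝ) / 20))) atTop (𝓝 0) :=
    (tendsto_rpow_neg_atTop (by norm_num : (0 : ℝ) < 1 / 20)).comp tendsto_natCast_atTop_atTop
  have ht : Tendsto (fun n : ℕ => 4 * c * (n : ℝ) ^ (-((1 : ℝ) / 20))) atTop (𝓝 0) := by
    simpa using ht0.const_mul (4 * c)
  have hevb : ∀ᶠ n : ℕ in atTop, 4 * c * (n : ℝ) ^ (-((1 : ℝ) / 20)) ≤ 1 / 2 :=
    ht.eventually (ge_mem_nhds (by norm_num : (0 : ℝ) < 1 / 2))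
  have hevc : ∀ᶠ n : ℕ in atTop, 4 * K₂ / μ ≤ Real.log n :=
    (Real.tendsto_log_atTop.comp tendsto_natCast_atTop_atTop).eventually_ge_atTop _
  obtain ⟨N₂, hN₂⟩ := eventually_atTop.1 ((heva.and hevb).and hevc)
  refine ⟨16 * c + 4 * K₂ / μ, by positivity, N₂, fun n hn k hk => ?_⟩
  obtain ⟨⟨ha, hb⟩, hlogc⟩ := hN₂ n hn
  have hn0 : (0 : ℝ) < n := by exact_mod_cast (show 0 < n by omega)
  have hn1r : (1 : ℝ) ≤ n := by exact_mod_cast (show 1 ≤ n by omega)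
  have hlogn : 0 < Real.log n := Real.log_pos (by exact_mod_cast (show 1 < n by omega))
  -- rpow bookkeeping
  set r4 : ℝ := (n : ℝ) ^ (-(1 : ℝ) / 4) with hr4def
  set r20 : ℝ := (n : ℝ) ^ (-((1 : ℝ) / 20)) with hr20def
  have hr4 : 0 ≤ r4 := Real.rpow_nonneg hn0.le _
  have hr4_20 : r4 ≤ r20 := Real.rpow_le_rpow_of_exponent_le hn1r (by norm_num)
  have hk5 : (k : ℝ) ≤ (n : ℝ) ^ ((1 : ℝ) / 5) := natCast_le_rpow_fifth hk
  have hkr : (k : ℝ) * r4 ≤ r20 := by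
    have h1 : (k : ℝ) * r4 ≤ (n : ℝ) ^ ((1 : ℝ) / 5) * r4 := mul_le_mul_of_nonneg_right hk5 hr4
    have h2 : (n : ℝ) ^ ((1 : ℝ) / 5) * r4 = r20 := by
      rw [hr4def, hr20def, ← Real.rpow_add hn0]; norm_num
    linarith
  have h4k : 4 * k ≤ n := four_mul_le_of_pow_five_le hk (by omega)
  have hk0 : (0 : ℝ) ≤ k := Nat.cast_nonneg k
  have hcr : 2 * c * ((k : ℝ) * r4) ≤ 1 / 4 := by nlinarith
  have hx1 : 4 * c * r4 ≤ 1 := by nlinarith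
  have hKlog : 0 ≤ (16 * c + 4 * K₂ / μ) * (1 / Real.log n) := by positivity
  obtain ⟨j, rfl | rfl⟩ := Nat.even_or_odd' k
  · -- even shift `k = 2j`
    have hjx : (j : ℝ) * (2 * c * (n : ℝ) ^ (-(1 : ℝ) / 4)) ≤ 1 / 2 := by
      have : (j : ℝ) ≤ ((2 * j : ℕ) : ℝ) := by exact_mod_cast (show j ≤ 2 * j by omega)
      rw [← hr4def]; nlinarith
    have h := evenShift_ratio hw hμ hc hdev (show 1 ≤ n by omega) (show N₁ + 2 * j ≤ n by omega)
      (show 4 * j ≤ n by omega) (by rw [← hr4def]; linarith) hjx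
    refine h.trans ?_
    rw [← hr4def]
    have hj2 : ((2 * j : ℕ) : ℝ) = 2 * (j : ℝ) := by push_cast; ring
    rw [hj2] at hkr ⊢
    have hj0 : (0 : ℝ) ≤ j := Nat.cast_nonneg j
    calc 4 * (j : ℝ) * (2 * c * r4) = 4 * c * ((2 * (j : ℝ)) * r4) := by ring
      _ ≤ (16 * c + 4 * K₂ / μ) * ((2 * (j : ℝ)) * r4) := by
          apply mul_le_mul_of_nonneg_right _ (by positivity)
          have : 0 ≤ 4 * K₂ / μ := by positivity
          linarith
      _ ≤ (16 * c + 4 * K₂ / μ) * ((2 * (j : ℝ)) * r4 + 1 / Real.log n) := by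
          apply mul_le_mul_of_nonneg_left _ (by positivity)
          have : 0 ≤ 1 / Real.log n := by positivity
          linarith
  · -- odd shift `k = 2j + 1`
    have hjx : (j : ℝ) * (4 * c * (n : ℝ) ^ (-(1 : ℝ) / 4)) ≤ 1 / 2 := by
      have : 2 * (j : ℝ) ≤ ((2 * j + 1 : ℕ) : ℝ) := by exact_mod_cast (show 2 * j ≤ 2 * j + 1 by omega)
      rw [← hr4def]; nlinarith
    have h := oddShift_ratio hw hμ hc hK₂ hdev hR16K (show 3 ≤ n by omega)
      (show N₁ + 2 * j ≤ n - 1 by omega) (show 4 * j ≤ n - 1 by omega) (by rw [← hr4def]; linarith)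
      hjx hlogc
    refine h.trans ?_
    rw [← hr4def]
    have hj2 : ((2 * j + 1 : ℕ) : ℝ) = 2 * (j : ℝ) + 1 := by push_cast; ring
    rw [hj2] at hkr ⊢
    have hj0 : (0 : ℝ) ≤ j := Nat.cast_nonneg j
    have hKμ : 0 ≤ 4 * K₂ / μ := by positivity
    have h1 : 32 * (j : ℝ) * c * r4 ≤ 16 * c * ((2 * (j : ℝ) + 1) * r4) := by nlinarith
    have h2 : 4 * K₂ / (μ * Real.log n) = 4 * K₂ / μ * (1 / Real.log n) := by field_simp
    rw [h2]
    have p1 : 0 ≤ c * (1 / Real.log n) := mul_nonneg hc (by positivity)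
    have p2 : 0 ≤ 4 * K₂ / μ * ((2 * (j : ℝ) + 1) * r4) :=
      mul_nonneg hKμ (mul_nonneg (by positivity) hr4)
    have p3 : 0 ≤ c * r4 := mul_nonneg hc hr4
    linarith [p1, p2, p3]

end RatioUniform

end Literature.Probability.RandomPlanarGeometry.SAW

end
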